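import Mathlib.LinearAlgebra.Eigenspace.Semisimple
import Mathlib.LinearAlgebra.Matrix.Basis
import Literature.Computability.AlgebraicComplexity.GLAnnihilator
import Literature.Barriers.ValiantsHypothesis.ShiftedPartialsMonotone
import Literature.AlgebraicGeometry.Motives.HypersurfaceFormsNonsingular
import HarnessLib

/-!
# Smooth forms of degree `≥ 3`: the stabiliser Lie algebra contains no semisimple element

Classical theorem (Matsumura–Monsky 1964, Thm. 1 [MatsumuraMonsky1963]; Poonen 2005, Thm. 2
[Poonen2005], p0002:L9 of the held text `paper:doi-10-1016-j-ffa-2004-12-001`: «If `n ≥ 1` and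
`d ≥ 3`, then `Lin X` is finite», with the proof «See the "Historical Remarks" section at the end
of [OS]. The result has apparently been known for at least one hundred years, at least when
`p = 0`. Matsumura and Monsky [MM] give a proof in arbitrary characteristic, at least when
`n ≥ 2`», p0002:L11): a smooth hypersurface of degree `d ≥ 3` has a FINITE group of linear
automorphisms. In the tree this is the open fact `poonen2005_thm_2`
(`Poonen05HypersurfaceLinearAutomorphisms.lean`, every algebraically closed field, any
characteristic). Over `ℂ`, by `finite_linStabilizer_iff_glAnn_eq_bot`
(`BI17FiniteStabilizerLocusProofs.lean`), finiteness of the stabiliser of a form `F` is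
equivalent to the vanishing of its annihilator `𝔤𝔩(W)_F = {X : Σ X_{ab} x_a ∂_b F = 0}` (`glAnn`,
the Lie algebra of the stabiliser).

This file proves, sorry-free and with no new facts, the SEMISIMPLE HALF of `𝔤𝔩(W)_F = 0` for a
nonsingular form `F ∈ ℂ[x₀,…,x_{n+1}]` of degree `d ≥ 3` (`IsNonsingularForm`, Hartshorne I Ex. 5.8):

* `eq_zero_of_mem_glAnn_of_isSemisimple` — a semisimple `X ∈ 𝔤𝔩(W)_F` is zero (the stabiliser
  contains no torus);
* `jordanChevalley_mem_glAnn_of_isSemisimple` — for ANY polynomial `f`, `𝔤𝔩(W)_f` contains the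
  Jordan–Chevalley parts of its elements (it is an algebraic Lie algebra);
* `isNilpotent_of_mem_glAnn_of_isNonsingularForm` — hence every `X ∈ 𝔤𝔩(W)_F` is nilpotent
  (the identity component of the stabiliser is unipotent).

The nilpotent half («a nilpotent `X ∈ 𝔤𝔩(W)_F` is zero», classically an `𝔰𝔩₂`-weight argument)
is NOT proved here, so neither `𝔤𝔩(W)_F = 0` nor `poonen2005_thm_2` is discharged.

## Route (elementary; not the printed proofs, which go through [OS]/[MM])

1. (§1) Chain rule: `X ∈ 𝔤𝔩(W)_{A·f} ↔ A⁻¹XA ∈ 𝔤𝔩(W)_f` (`mem_glAnn_linSubst_iff`), so one may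
   diagonalise a semisimple `X` (§5, eigenbasis from Mathlib's `iSup_eigenspace_eq_top`).
2. (§2) `diag(a)` multiplies the monomial `x^e` by its weight `Σ aᵢeᵢ`; if `diag(a) ∈ 𝔤𝔩(W)_F`
   every monomial of `F` has weight `0`.
3. (§3) Nonsingularity is invariant under `A·` and forces, for every `i`, a monomial
   `xᵢ^{d-1}x_{j(i)}` in `F` (else the coordinate point `eᵢ` is singular).
4. (§4) The relations `(d-1)aᵢ + a_{j(i)} = 0` give `a_{jᵏ(i)} = (1-d)ᵏaᵢ`; two iterates coincide,
   and `|1-d| ≥ 2` forces `a = 0`.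
5. (§6–§7) For `X = S + N` (Jordan–Chevalley, Mathlib `Module.End.exists_isNilpotent_isSemisimple`),
   in an eigenbasis of `S` the operator `N·` preserves the `S`-weight components and is locally
   nilpotent (Leibniz), so on a component of weight `c ≠ 0`, where it would act as `-c`, the
   component vanishes: `S ∈ 𝔤𝔩(W)_f`.

Honest framing: classical invariant theory of smooth forms; nothing here bears on VP versus VNP.

## References

* B. Poonen, *Varieties without extra automorphisms III: hypersurfaces*, Finite Fields Appl. 11
  (2005) 230–268, Thm. 2. [Poonen2005]
* H. Matsumura, P. Monsky, *On the automorphisms of hypersurfaces*, J. Math. Kyoto Univ. 3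
  (1963/64) 347–361, Thm. 1 (not held; quoted after Poonen). [MatsumuraMonsky1963]
* R. Hartshorne, *Algebraic Geometry*, GTM 52 (1977), I Ex. 5.8. [Hartshorne1977]
-/

noncomputable section

open MvPolynomial Matrix

namespace Literature.Computability.AlgebraicComplexity

/-! ### §1 Conjugation: `𝔤𝔩(W)_{A·f} = A 𝔤𝔩(W)_f A⁻¹` -/

section Conjugation

variable {σ : Type*} [Fintype σ] [DecidableEq σ]

/-- Chain rule for the action on `glTangentMap`: if `X A = A Y` then `(X·)(A·f) = A·((Y·) f)`,
i.e. `Σ X_{ab} x_a ∂_b (A·f) = A·(Σ Y_{ci} x_c ∂_i f)`. [cite: LandsbergManivelRessayre2013, §3.5 (p. 481)] -/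
theorem glTangentMap_linSubst_of_mul_eq (A X Y : Matrix σ σ ℂ) (h : X * A = A * Y)
    (f : MvPolynomial σ ℂ) :
    glTangentMap (linSubst σ ℂ A f) X = linSubst σ ℂ A (glTangentMap f Y) := by
  set L := linSubst σ ℂ A with hL
  have lhs : glTangentMap (L f) X =
      ∑ a, ∑ i, (X * A) a i • ((MvPolynomial.X a : MvPolynomial σ ℂ) * L (pderiv i f)) := by
    rw [glTangentMap_apply]
    refine Finset.sum_congr rfl fun a _ => ?_
    have step : ∀ b, X a b • ((MvPolynomial.X a : MvPolynomial σ ℂ) * pderiv b (L f)) =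
        ∑ i, (X a b * A b i) • ((MvPolynomial.X a : MvPolynomial σ ℂ) * L (pderiv i f)) := by
      intro b
      rw [hL, Literature.Barriers.ValiantsHypothesis.pderiv_linSubst, Finset.mul_sum,
        Finset.smul_sum]
      refine Finset.sum_congr rfl fun i _ => ?_
      rw [mul_smul_comm, smul_smul]
    simp_rw [step]
    rw [Finset.sum_comm]
    refine Finset.sum_congr rfl fun i _ => ?_
    rw [← Finset.sum_smul, Matrix.mul_apply]
  have rhs : L (glTangentMap f Y) =
      ∑ a, ∑ i, (A * Y) a i • ((MvPolynomial.X a : MvPolynomial σ ℂ) * L (pderiv i f)) := by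
    rw [glTangentMap_apply, map_sum]
    simp only [map_sum, map_smul, map_mul]
    have step : ∀ c i, Y c i • (L (MvPolynomial.X c) * L (pderiv i f)) =
        ∑ a, (A a c * Y c i) • ((MvPolynomial.X a : MvPolynomial σ ℂ) * L (pderiv i f)) := by
      intro c i
      rw [hL, linSubst_X, Finset.sum_mul, Finset.smul_sum]
      refine Finset.sum_congr rfl fun a _ => ?_
      rw [smul_mul_assoc, smul_smul, mul_comm (Y c i)]
    simp_rw [step]
    rw [Finset.sum_comm]
    have h3 : ∀ i : σ, (∑ c, ∑ a, (A a c * Y c i) •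
        ((MvPolynomial.X a : MvPolynomial σ ℂ) * L (pderiv i f))) =
        ∑ a, ∑ c, (A a c * Y c i) • ((MvPolynomial.X a : MvPolynomial σ ℂ) * L (pderiv i f)) :=
      fun i => Finset.sum_comm
    simp_rw [h3]
    rw [Finset.sum_comm]
    refine Finset.sum_congr rfl fun a _ => Finset.sum_congr rfl fun i _ => ?_
    rw [← Finset.sum_smul, Matrix.mul_apply]
  rw [lhs, rhs, h]

/-- `A·` is injective for invertible `A` (its inverse is `A⁻¹·`). [cite: LandsbergManivelRessayre2013, §3.5 (p. 481)] -/
theorem linSubst_injective_of_isUnit (A : Matrix σ σ ℂ) (hA : IsUnit A.det) :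
    Function.Injective (linSubst σ ℂ A) := by
  intro p q hpq
  have h := congr_arg (linSubst σ ℂ A⁻¹) hpq
  rwa [← AlgHom.comp_apply, ← AlgHom.comp_apply, ← linSubst_mul, Matrix.nonsing_inv_mul A hA,
    linSubst_one, AlgHom.id_apply, AlgHom.id_apply] at h

/-- **Chain rule**: `(X·)(A·f) = A·((A⁻¹XA·) f)` for invertible `A`. [cite: LandsbergManivelRessayre2013, §3.5 (p. 481)] -/
theorem glTangentMap_linSubst (A : Matrix σ σ ℂ) (hA : IsUnit A.det) (X : Matrix σ σ ℂ)
    (f : MvPolynomial σ ℂ) :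
    glTangentMap (linSubst σ ℂ A f) X = linSubst σ ℂ A (glTangentMap f (A⁻¹ * X * A)) :=
  glTangentMap_linSubst_of_mul_eq A X _ (by rw [← Matrix.mul_assoc, ← Matrix.mul_assoc,
    Matrix.mul_nonsing_inv A hA, Matrix.one_mul]) f

/-- **Conjugation of the annihilator**: `X ∈ 𝔤𝔩(W)_{A·f} ↔ A⁻¹XA ∈ 𝔤𝔩(W)_f` for invertible `A`
(the Lie algebra of the stabiliser of `A·f` is the conjugate of that of `f`). [cite: LandsbergManivelRessayre2013, §3.5 (p. 481)] -/
theorem mem_glAnn_linSubst_iff (A : Matrix σ σ ℂ) (hA : IsUnit A.det) (X : Matrix σ σ ℂ)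
    (f : MvPolynomial σ ℂ) :
    X ∈ glAnn (linSubst σ ℂ A f) ↔ A⁻¹ * X * A ∈ glAnn f := by
  simp only [glAnn, LinearMap.mem_ker]
  rw [glTangentMap_linSubst A hA, map_eq_zero_iff _ (linSubst_injective_of_isUnit A hA)]

end Conjugation

/-! ### §2 Diagonal matrices act on coefficients by weights -/

section Diagonal

variable {σ : Type*} [Fintype σ] [DecidableEq σ]

omit [Fintype σ] in
/-- `coeff_e (x_i ∂_i f) = e_i · coeff_e f`. [folklore] -/
private theorem coeff_X_mul_pderiv (i : σ) (f : MvPolynomial σ ℂ) (e : σ →₀ ℕ) :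
    coeff e (X i * pderiv i f) = (e i : ℂ) * coeff e f := by
  rw [coeff_X_mul']
  split_ifs with hi
  · rw [coeff_pderiv]
    have h1 : 1 ≤ e i := Nat.one_le_iff_ne_zero.mpr (Finsupp.mem_support_iff.mp hi)
    have he : e - Finsupp.single i 1 + Finsupp.single i 1 = e := by
      ext l
      simp only [Finsupp.coe_add, Finsupp.coe_tsub, Pi.add_apply, Pi.sub_apply,
        Finsupp.single_apply]
      split_ifs with hl
      · subst hl; omega
      · omega
    rw [he, Finsupp.tsub_apply, Finsupp.single_eq_same, Nat.cast_sub h1, Nat.cast_one,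
      sub_add_cancel, mul_comm]
  · rw [Finsupp.notMem_support_iff.mp hi, Nat.cast_zero, zero_mul]

/-- The diagonal matrix `diag(a)` acts on `f` monomial by monomial, multiplying `x^e` by its
`a`-weight `Σ aᵢ eᵢ`: `coeff_e (Σ aᵢ xᵢ ∂ᵢ f) = (Σ aᵢ eᵢ) coeff_e f`. [cite: Poonen2005, Thm. 2 (p0002:L9); proof step, not in the source] -/
theorem coeff_glTangentMap_diagonal (a : σ → ℂ) (f : MvPolynomial σ ℂ) (e : σ →₀ ℕ) :
    coeff e (glTangentMap f (diagonal a)) = (∑ i, a i * e i) * coeff e f := by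
  rw [glTangentMap_apply]
  have hdiag : ∀ i : σ, ∑ j, diagonal a i j • ((X i : MvPolynomial σ ℂ) * pderiv j f) =
      a i • ((X i : MvPolynomial σ ℂ) * pderiv i f) := by
    intro i
    rw [Finset.sum_eq_single i (fun j _ hji => by rw [diagonal_apply_ne a (Ne.symm hji), zero_smul])
      (fun h => absurd (Finset.mem_univ i) h), diagonal_apply_eq]
  simp_rw [hdiag]
  rw [coeff_sum, Finset.sum_mul]
  refine Finset.sum_congr rfl fun i _ => ?_
  rw [coeff_smul, coeff_X_mul_pderiv, smul_eq_mul, mul_assoc]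

/-- If `diag(a)` annihilates `f`, every monomial of `f` has `a`-weight zero. [cite: Poonen2005, Thm. 2 (p0002:L9); proof step, not in the source] -/
theorem weight_eq_zero_of_diagonal_mem_glAnn {a : σ → ℂ} {f : MvPolynomial σ ℂ}
    (h : diagonal a ∈ glAnn f) {e : σ →₀ ℕ} (he : coeff e f ≠ 0) : ∑ i, a i * e i = 0 := by
  have h0 : glTangentMap f (diagonal a) = 0 := by simpa [glAnn] using h
  have := coeff_glTangentMap_diagonal a f e
  rw [h0, coeff_zero] at this
  exact (mul_eq_zero.mp this.symm).resolve_right he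

end Diagonal

/-! ### §3 Nonsingular forms: transport along `A·` and the coordinate points -/

section Nonsingular

open Literature.AlgebraicGeometry.Motives.SmoothHypersurface

variable {n : ℕ}

/-- Linear algebra in an ideal: if all `Σᵢ A j i • vᵢ ∈ 𝔭` and `A` is invertible then all
`vᵢ ∈ 𝔭`. [folklore] -/
private theorem mem_of_forall_sum_smul_mem {σ : Type*} [Fintype σ] [DecidableEq σ]
    {R : Type*} [CommRing R] [Algebra ℂ R] (A : Matrix σ σ ℂ) (hA : IsUnit A.det)
    (𝔭 : Ideal R) (v : σ → R) (h : ∀ j, ∑ i, A j i • v i ∈ 𝔭) (l : σ) : v l ∈ 𝔭 := by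
  have key : v l = ∑ j, A⁻¹ l j • ∑ i, A j i • v i := by
    simp_rw [Finset.smul_sum, smul_smul]
    rw [Finset.sum_comm]
    simp_rw [← Finset.sum_smul, ← Matrix.mul_apply, Matrix.nonsing_inv_mul A hA]
    rw [Finset.sum_eq_single l (fun i _ hil => by rw [Matrix.one_apply_ne (Ne.symm hil), zero_smul])
      (fun h => absurd (Finset.mem_univ l) h), Matrix.one_apply_eq, one_smul]
  rw [key]
  exact 𝔭.sum_mem fun j _ => Submodule.smul_of_tower_mem 𝔭 _ (h j)

/-- **Nonsingularity is invariant under invertible linear substitutions** (pull the prime back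
along the automorphism `A·`; the chain rule and `A⁻¹` move the partials and the variables).
[cite: Hartshorne1977, I Ex. 5.8] -/
theorem isNonsingularForm_linSubst (A : Matrix (Fin (n + 2)) (Fin (n + 2)) ℂ) (hA : IsUnit A.det)
    {F : MvPolynomial (Fin (n + 2)) ℂ} (hF : IsNonsingularForm ℂ F) :
    IsNonsingularForm ℂ (linSubst (Fin (n + 2)) ℂ A F) := by
  intro 𝔭 h𝔭 hF𝔭 hder i
  set φ := linSubst (Fin (n + 2)) ℂ A with hφ
  -- the partials `φ (∂_l F)` lie in `𝔭`
  have hderF : ∀ l, φ (pderiv l F) ∈ 𝔭 := by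
    refine mem_of_forall_sum_smul_mem A hA 𝔭 (fun l => φ (pderiv l F)) (fun j => ?_)
    rw [hφ, ← Literature.Barriers.ValiantsHypothesis.pderiv_linSubst]
    exact hder j
  -- pull back along `φ`
  have h𝔮 : (𝔭.comap φ).IsPrime := Ideal.comap_isPrime φ 𝔭
  have hX : ∀ l, φ (X l) ∈ 𝔭 := fun l =>
    hF (𝔭.comap φ) h𝔮 hF𝔭 (fun j => hderF j) l
  refine mem_of_forall_sum_smul_mem Aᵀ (by rw [Matrix.det_transpose]; exact hA) 𝔭
    (fun l => (X l : MvPolynomial (Fin (n + 2)) ℂ)) (fun j => ?_) i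
  have := hX j
  rw [hφ, linSubst_X] at this
  simpa only [Matrix.transpose_apply] using this

/-- A form evaluated at the coordinate point `eᵢ` is its `xᵢᵐ`-coefficient. [folklore] -/
private theorem eval_pi_single_of_isHomogeneous {σ : Type*} [Fintype σ] [DecidableEq σ]
    {g : MvPolynomial σ ℂ} {m : ℕ} (hg : g.IsHomogeneous m) (i : σ) :
    eval (Pi.single i 1 : σ → ℂ) g = coeff (Finsupp.single i m) g := by
  rw [eval_eq']
  have hmain : (∏ l, (Pi.single i 1 : σ → ℂ) l ^ (Finsupp.single i m) l) = 1 := by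
    refine Finset.prod_eq_one fun l _ => ?_
    by_cases hl : l = i
    · subst hl; simp
    · rw [Finsupp.single_eq_of_ne hl, pow_zero]
  rw [Finset.sum_eq_single (Finsupp.single i m)]
  · rw [hmain, mul_one]
  · intro e he hne
    have hcoeff : coeff e g ≠ 0 := mem_support_iff.mp he
    -- `e` is not supported on `{i}` alone
    have hl : ∃ l, l ≠ i ∧ e l ≠ 0 := by
      by_contra hcon
      push Not at hcon
      apply hne
      have hei : e = Finsupp.single i (e i) := by
        ext l
        by_cases hl : l = i
        · subst hl; rw [Finsupp.single_eq_same]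
        · rw [Finsupp.single_eq_of_ne hl]; exact hcon l hl
      have hdeg := hg hcoeff
      rw [hei] at hdeg ⊢
      simp only [Finsupp.weight_apply, Pi.one_apply, smul_eq_mul, mul_one,
        Finsupp.sum_single_index] at hdeg
      rw [hdeg]
    obtain ⟨l, hli, hel⟩ := hl
    rw [Finset.prod_eq_zero (Finset.mem_univ l) (by rw [Pi.single_eq_of_ne hli, zero_pow hel]),
      mul_zero]
  · intro h
    rw [notMem_support_iff.mp h, zero_mul]

/-- **Coordinate points of a nonsingular form**: for a nonsingular form `F` of degree `d ≥ 1` and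
every variable `xᵢ` some monomial `xᵢ^{d-1} xⱼ` occurs in `F` (possibly `j = i`) — otherwise `F`
and all `∂ⱼF` vanish at the coordinate point `eᵢ`. [cite: Hartshorne1977, I Ex. 5.8] -/
theorem exists_coeff_ne_zero_of_isNonsingularForm {F : MvPolynomial (Fin (n + 2)) ℂ}
    (hF : IsNonsingularForm ℂ F) {d : ℕ} (hFd : F.IsHomogeneous d) (hd : 1 ≤ d) (i : Fin (n + 2)) :
    ∃ j, coeff (Finsupp.single i (d - 1) + Finsupp.single j 1) F ≠ 0 := by
  by_contra hcon
  push Not at hcon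
  set 𝔭 : Ideal (MvPolynomial (Fin (n + 2)) ℂ) := RingHom.ker (eval (Pi.single i 1 : Fin (n + 2) → ℂ))
  have hF𝔭 : F ∈ 𝔭 := by
    change F ∈ RingHom.ker _
    rw [RingHom.mem_ker, eval_pi_single_of_isHomogeneous hFd]
    have := hcon i
    rwa [← Finsupp.single_add, Nat.sub_add_cancel hd] at this
  have hder : ∀ j, pderiv j F ∈ 𝔭 := by
    intro j
    change pderiv j F ∈ RingHom.ker _
    rw [RingHom.mem_ker, eval_pi_single_of_isHomogeneous hFd.pderiv, coeff_pderiv, hcon j, zero_mul]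
  have hX := hF 𝔭 (RingHom.ker_isPrime _) hF𝔭 hder i
  change (X i : MvPolynomial (Fin (n + 2)) ℂ) ∈ RingHom.ker _ at hX
  rw [RingHom.mem_ker, eval_X, Pi.single_eq_same] at hX
  exact one_ne_zero hX

end Nonsingular

/-! ### §4 The weight argument -/

section Weights

/-- **No nonzero weights**: if `(d-1)·aᵢ + a_{J i} = 0` for all `i` with `d ≥ 3`, then `a = 0`
(iterate: `a_{Jᵏ i} = (1-d)ᵏ aᵢ`; two iterates coincide by finiteness, and `(1-d)ᵖ ≠ (1-d)ʳ` for
`p ≠ r` as `|1-d| ≥ 2`). [folklore] -/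
private theorem eq_zero_of_weight_relations {σ : Type*} [Finite σ] (a : σ → ℂ) (J : σ → σ) {d : ℕ}
    (hd : 3 ≤ d) (h : ∀ i, ((d : ℂ) - 1) * a i + a (J i) = 0) (i : σ) : a i = 0 := by
  set q : ℤ := 1 - (d : ℤ) with hq
  have hqC : ((q : ℤ) : ℂ) = -((d : ℂ) - 1) := by rw [hq]; push_cast; ring
  have hiter : ∀ k : ℕ, a (J^[k] i) = (q : ℂ) ^ k * a i := by
    intro k
    induction k with
    | zero => simp
    | succ k ih =>
      rw [Function.iterate_succ_apply', pow_succ, hqC]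
      have := h (J^[k] i)
      rw [ih, hqC] at this
      linear_combination this
  obtain ⟨p, r, hpr, hJ⟩ := Finite.exists_ne_map_eq_of_infinite (fun k : ℕ => J^[k] i)
  have hne : (q : ℂ) ^ p ≠ (q : ℂ) ^ r := by
    intro hC
    have hZ : q ^ p = q ^ r := by exact_mod_cast hC
    have habs : 2 ≤ q.natAbs := by rw [hq]; omega
    have := congr_arg Int.natAbs hZ
    rw [Int.natAbs_pow, Int.natAbs_pow] at this
    exact hpr (Nat.pow_right_injective habs this)
  have hmul : ((q : ℂ) ^ p - (q : ℂ) ^ r) * a i = 0 := by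
    have h1 := hiter p
    have h2 := hiter r
    simp only [hJ] at h1
    rw [h1] at h2
    linear_combination h2
  exact (mul_eq_zero.mp hmul).resolve_left (sub_ne_zero.mpr hne)

end Weights

/-! ### §5 No torus in the stabiliser of a smooth form of degree `≥ 3` -/

section Main

open Literature.AlgebraicGeometry.Motives.SmoothHypersurface

variable {n : ℕ}

/-- **A diagonal matrix annihilating a nonsingular form of degree `d ≥ 3` is zero**: every
monomial of `F` has weight `0`; by nonsingularity each `xᵢ^{d-1}xⱼ₍ᵢ₎` occurs, giving
`(d-1)aᵢ + a_{j(i)} = 0`, hence `a = 0`. [cite: Poonen2005, Thm. 2 (p0002:L9); infinitesimal semisimple case — not the printed proof] -/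
theorem eq_zero_of_diagonal_mem_glAnn {F : MvPolynomial (Fin (n + 2)) ℂ}
    (hF : IsNonsingularForm ℂ F) {d : ℕ} (hFd : F.IsHomogeneous d) (hd : 3 ≤ d)
    {a : Fin (n + 2) → ℂ} (ha : diagonal a ∈ glAnn F) : a = 0 := by
  choose J hJ using exists_coeff_ne_zero_of_isNonsingularForm hF hFd (by omega)
  have hrel : ∀ i, ((d : ℂ) - 1) * a i + a (J i) = 0 := by
    intro i
    have hw := weight_eq_zero_of_diagonal_mem_glAnn ha (hJ i)
    have hsum : ∑ l, a l * ((Finsupp.single i (d - 1) + Finsupp.single (J i) 1 : Fin (n + 2) →₀ ℕ) l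
        : ℂ) = ((d : ℂ) - 1) * a i + a (J i) := by
      simp only [Finsupp.coe_add, Pi.add_apply, Nat.cast_add, mul_add, Finset.sum_add_distrib,
        Finsupp.single_apply, Nat.cast_ite, Nat.cast_zero, mul_ite, mul_zero]
      rw [Finset.sum_ite_eq Finset.univ i, Finset.sum_ite_eq Finset.univ (J i)]
      simp only [Finset.mem_univ, if_true, Nat.cast_sub (by omega : 1 ≤ d), Nat.cast_one]
      ring
    rw [hsum] at hw
    exact hw
  funext i
  exact eq_zero_of_weight_relations a J hd hrel i

/-- **Conjugate form**: an element of `𝔤𝔩(W)_F` conjugate to a diagonal matrix,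
`X = P diag(a) P⁻¹`, is zero when `F` is a nonsingular form of degree `≥ 3` (transport `F` to
`P⁻¹·F`, where `diag(a)` itself annihilates). [cite: Poonen2005, Thm. 2 (p0002:L9); infinitesimal semisimple case] -/
theorem eq_zero_of_mem_glAnn_of_conj_diagonal {F : MvPolynomial (Fin (n + 2)) ℂ}
    (hF : IsNonsingularForm ℂ F) {d : ℕ} (hFd : F.IsHomogeneous d) (hd : 3 ≤ d)
    {X P : Matrix (Fin (n + 2)) (Fin (n + 2)) ℂ} {a : Fin (n + 2) → ℂ} (hP : IsUnit P.det)
    (hX : X = P * diagonal a * P⁻¹) (hmem : X ∈ glAnn F) : X = 0 := by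
  have hP' : IsUnit P⁻¹.det := Matrix.isUnit_nonsing_inv_det P hP
  have hmem' : diagonal a ∈ glAnn (linSubst (Fin (n + 2)) ℂ P⁻¹ F) := by
    rw [mem_glAnn_linSubst_iff P⁻¹ hP', Matrix.nonsing_inv_nonsing_inv P hP, ← hX]
    exact hmem
  have ha : a = 0 := eq_zero_of_diagonal_mem_glAnn (isNonsingularForm_linSubst P⁻¹ hP' hF)
    (linSubst_isHomogeneous P⁻¹ hFd) hd hmem'
  rw [hX, ha]
  simp

/-- **A semisimple matrix is conjugate to a diagonal one** over `ℂ` (eigenbasis). [cite: Poonen2005, Thm. 2 (p0002:L9); proof step, not in the source] -/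
theorem exists_conj_diagonal_of_isSemisimple {σ : Type*} [Fintype σ] [DecidableEq σ]
    (X : Matrix σ σ ℂ) (hX : Module.End.IsSemisimple (Matrix.toLin' X)) :
    ∃ (P : Matrix σ σ ℂ) (a : σ → ℂ), IsUnit P.det ∧ X = P * diagonal a * P⁻¹ := by
  set f : Module.End ℂ (σ → ℂ) := Matrix.toLin' X with hf
  have hint : DirectSum.IsInternal (Module.End.eigenspace f) :=
    DirectSum.isInternal_submodule_of_iSupIndep_of_iSup_eq_top
      (Module.End.eigenspaces_iSupIndep f) hX.iSup_eigenspace_eq_top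
  let B := hint.collectedBasis fun μ => Module.Free.chooseBasis ℂ (Module.End.eigenspace f μ)
  let e := B.indexEquiv (Pi.basisFun ℂ σ)
  let b : Module.Basis σ ℂ (σ → ℂ) := B.reindex e
  set μ : σ → ℂ := fun k => (e.symm k).1 with hμ
  have hb : ∀ k, f (b k) = μ k • b k := by
    intro k
    have hk : b k = B (e.symm k) := by simp [b]
    rw [hk]
    exact Module.End.mem_eigenspace_iff.mp (hint.collectedBasis_mem _ (e.symm k))
  set P : Matrix σ σ ℂ := (Pi.basisFun ℂ σ).toMatrix b with hPdef
  have hPapply : ∀ i j, P i j = b j i := fun i j => by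
    rw [hPdef, Module.Basis.toMatrix_apply, Pi.basisFun_repr]
  have hPunit : IsUnit P.det :=
    Matrix.isUnit_det_of_right_inverse (Module.Basis.toMatrix_mul_toMatrix_flip (Pi.basisFun ℂ σ) b)
  have hXP : X * P = P * diagonal μ := by
    ext i j
    rw [Matrix.mul_diagonal, Matrix.mul_apply]
    simp_rw [hPapply]
    have := congr_fun (hb j) i
    rw [hf, Matrix.toLin'_apply, Pi.smul_apply, smul_eq_mul, Matrix.mulVec, dotProduct] at this
    rw [this, mul_comm]
  refine ⟨P, μ, hPunit, ?_⟩
  rw [← hXP, Matrix.mul_assoc, Matrix.mul_nonsing_inv P hPunit, Matrix.mul_one]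

/-- **No torus in the stabiliser of a smooth form of degree `≥ 3` (infinitesimal form of the
Matsumura–Monsky finiteness theorem, semisimple half).** If `F ∈ ℂ[x₀,…,x_{n+1}]` is a nonsingular
form of degree `d ≥ 3` and `X ∈ 𝔤𝔩_{n+2}(ℂ)` is semisimple with `X ∈ 𝔤𝔩(W)_F` (i.e.
`Σ X_{ab} x_a ∂_b F = 0`), then `X = 0`. Equivalently: the stabiliser of `F` in `GL_{n+2}(ℂ)`
contains no one-parameter torus. Typed vs printed: Poonen's Theorem 2 / Matsumura–Monsky's
Theorem 1 assert that the whole linear automorphism group is FINITE (over any algebraically closed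
field); this is the semisimple part of the Lie-algebra statement `𝔤𝔩(W)_F = 0` over `ℂ`, which by
`finite_linStabilizer_iff_glAnn_eq_bot` is equivalent to finiteness; the nilpotent part is not
proved here. [cite: Poonen2005, Thm. 2 (p0002:L9)] -/
theorem eq_zero_of_mem_glAnn_of_isSemisimple {F : MvPolynomial (Fin (n + 2)) ℂ}
    (hF : IsNonsingularForm ℂ F) {d : ℕ} (hFd : F.IsHomogeneous d) (hd : 3 ≤ d)
    {X : Matrix (Fin (n + 2)) (Fin (n + 2)) ℂ} (hX : Module.End.IsSemisimple (Matrix.toLin' X))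
    (hmem : X ∈ glAnn F) : X = 0 := by
  obtain ⟨P, a, hP, hXP⟩ := exists_conj_diagonal_of_isSemisimple X hX
  exact eq_zero_of_mem_glAnn_of_conj_diagonal hF hFd hd hP hXP hmem

end Main

/-! ### §6 The derivation `h ↦ X·h` for a fixed matrix: linearity, Leibniz, nilpotency -/

section DerivationAlong

variable {σ : Type*} [Fintype σ] [DecidableEq σ]

omit [DecidableEq σ] in
/-- `X·(g + h) = X·g + X·h`. [cite: LandsbergManivelRessayre2013, §3.4 (p. 479)] -/
theorem glTangentMap_add_left (g h : MvPolynomial σ ℂ) (N : Matrix σ σ ℂ) :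
    glTangentMap (g + h) N = glTangentMap g N + glTangentMap h N := by
  simp only [glTangentMap_apply, map_add, mul_add, smul_add, Finset.sum_add_distrib]

omit [DecidableEq σ] in
/-- `X·(r g) = r (X·g)`. [cite: LandsbergManivelRessayre2013, §3.4 (p. 479)] -/
theorem glTangentMap_smul_left (r : ℂ) (g : MvPolynomial σ ℂ) (N : Matrix σ σ ℂ) :
    glTangentMap (r • g) N = r • glTangentMap g N := by
  simp only [glTangentMap_apply, Derivation.map_smul, Finset.smul_sum, mul_smul_comm, smul_comm r]

omit [DecidableEq σ] in
/-- Leibniz: `X·(g h) = g (X·h) + h (X·g)`. [cite: LandsbergManivelRessayre2013, §3.4 (p. 479)] -/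
theorem glTangentMap_mul_left (g h : MvPolynomial σ ℂ) (N : Matrix σ σ ℂ) :
    glTangentMap (g * h) N = g * glTangentMap h N + h * glTangentMap g N := by
  simp only [glTangentMap_apply, Derivation.leibniz, smul_eq_mul, mul_add, smul_add,
    Finset.sum_add_distrib, Finset.mul_sum]
  congr 1 <;> refine Finset.sum_congr rfl fun a _ => Finset.sum_congr rfl fun b _ => ?_ <;>
    rw [mul_smul_comm] <;> ring_nf

omit [DecidableEq σ] in
/-- `X·c = 0` for a constant `c`. [cite: LandsbergManivelRessayre2013, §3.4 (p. 479)] -/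
theorem glTangentMap_C_left (r : ℂ) (N : Matrix σ σ ℂ) :
    glTangentMap (C r : MvPolynomial σ ℂ) N = 0 := by
  simp [glTangentMap_apply]

omit [DecidableEq σ] in
/-- `X·0 = 0`. [folklore] -/
private theorem glTangentMap_zero_left (N : Matrix σ σ ℂ) :
    glTangentMap (0 : MvPolynomial σ ℂ) N = 0 := by
  have h := glTangentMap_C_left (σ := σ) 0 N
  rwa [C_0] at h

omit [DecidableEq σ] in
/-- `(X·)ᵏ 0 = 0`. [folklore] -/
private theorem iterate_glTangentMap_zero (N : Matrix σ σ ℂ) (k : ℕ) :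
    (fun h => glTangentMap h N)^[k] (0 : MvPolynomial σ ℂ) = 0 := by
  induction k with
  | zero => rfl
  | succ k ih => rw [Function.iterate_succ_apply, glTangentMap_zero_left, ih]

/-- On linear forms `X·` acts by the matrix: `X·(Σ vᵢ xᵢ) = Σ (X v)ᵢ xᵢ`. [cite: LandsbergManivelRessayre2013, §3.4 (p. 479)] -/
theorem glTangentMap_linearForm (v : σ → ℂ) (N : Matrix σ σ ℂ) :
    glTangentMap (∑ i, v i • (X i : MvPolynomial σ ℂ)) N = ∑ i, (N *ᵥ v) i • (X i : MvPolynomial σ ℂ) := by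
  rw [glTangentMap_apply]
  refine Finset.sum_congr rfl fun a _ => ?_
  have hder : ∀ b, pderiv b (∑ i, v i • (X i : MvPolynomial σ ℂ)) = C (v b) := by
    intro b
    rw [map_sum, Finset.sum_eq_single b (fun i _ hib => by
      rw [Derivation.map_smul, pderiv_X, Pi.single_eq_of_ne' hib.symm, smul_zero])
      (fun h => absurd (Finset.mem_univ b) h), Derivation.map_smul, pderiv_X, Pi.single_eq_same,
      smul_eq_C_mul, mul_one]
  simp_rw [hder, Matrix.mulVec, dotProduct, Finset.sum_smul]
  refine Finset.sum_congr rfl fun b _ => ?_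
  rw [mul_comm (X a : MvPolynomial σ ℂ), ← smul_eq_C_mul, smul_smul]

/-- Iterating on linear forms: `(X·)ᵏ (Σ vᵢ xᵢ) = Σ (Xᵏ v)ᵢ xᵢ`. [cite: LandsbergManivelRessayre2013, §3.4 (p. 479)] -/
theorem iterate_glTangentMap_linearForm (v : σ → ℂ) (N : Matrix σ σ ℂ) (k : ℕ) :
    (fun h => glTangentMap h N)^[k] (∑ i, v i • (X i : MvPolynomial σ ℂ)) =
      ∑ i, ((N ^ k) *ᵥ v) i • (X i : MvPolynomial σ ℂ) := by
  induction k with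
  | zero => simp
  | succ k ih =>
    rw [Function.iterate_succ_apply', ih, glTangentMap_linearForm, Matrix.mulVec_mulVec, ← pow_succ']

omit [DecidableEq σ] in
/-- Iterates of `X·` are additive. [folklore] -/
private theorem iterate_glTangentMap_add (g h : MvPolynomial σ ℂ) (N : Matrix σ σ ℂ) (k : ℕ) :
    (fun h => glTangentMap h N)^[k] (g + h) =
      (fun h => glTangentMap h N)^[k] g + (fun h => glTangentMap h N)^[k] h := by
  induction k with
  | zero => rfl
  | succ k ih => rw [Function.iterate_succ_apply', ih, glTangentMap_add_left,
      ← Function.iterate_succ_apply' (fun h => glTangentMap h N),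
      ← Function.iterate_succ_apply' (fun h => glTangentMap h N)]

omit [DecidableEq σ] in
/-- Iterates of `X·` commute with scalars. [folklore] -/
private theorem iterate_glTangentMap_smul (r : ℂ) (g : MvPolynomial σ ℂ) (N : Matrix σ σ ℂ) (k : ℕ) :
    (fun h => glTangentMap h N)^[k] (r • g) = r • (fun h => glTangentMap h N)^[k] g := by
  induction k with
  | zero => rfl
  | succ k ih => rw [Function.iterate_succ_apply', ih, glTangentMap_smul_left,
      ← Function.iterate_succ_apply' (fun h => glTangentMap h N)]

omit [DecidableEq σ] in
/-- Leibniz for iterates, qualitative form: if `(X·)ⁱ g = 0` for `i ≥ A` and `(X·)ʲ h = 0` for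
`j ≥ B`, then `(X·)ᵏ (g h) = 0` for `k ≥ A + B`. [folklore] -/
private theorem iterate_glTangentMap_mul_eq_zero (N : Matrix σ σ ℂ) :
    ∀ (s : ℕ) (g h : MvPolynomial σ ℂ) (A B : ℕ), A + B = s →
      (∀ i, A ≤ i → (fun h => glTangentMap h N)^[i] g = 0) →
      (∀ j, B ≤ j → (fun h => glTangentMap h N)^[j] h = 0) →
      ∀ k, s ≤ k → (fun h => glTangentMap h N)^[k] (g * h) = 0 := by
  intro s
  induction s with
  | zero =>
    intro g h A B hAB hg _ k _
    have hg0 : g = 0 := by simpa using hg 0 (by omega)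
    rw [hg0, zero_mul, iterate_glTangentMap_zero]
  | succ s ih =>
    intro g h A B hAB hg hh k hk
    rcases Nat.eq_zero_or_pos A with hA | hA
    · have hg0 : g = 0 := by simpa using hg 0 (by omega)
      rw [hg0, zero_mul, iterate_glTangentMap_zero]
    rcases Nat.eq_zero_or_pos B with hB | hB
    · have hh0 : h = 0 := by simpa using hh 0 (by omega)
      rw [hh0, mul_zero, iterate_glTangentMap_zero]
    obtain ⟨k, rfl⟩ : ∃ k', k = k' + 1 := ⟨k - 1, by omega⟩
    rw [Function.iterate_succ_apply, glTangentMap_mul_left, iterate_glTangentMap_add]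
    have h1 : (fun h => glTangentMap h N)^[k] (g * glTangentMap h N) = 0 :=
      ih g (glTangentMap h N) A (B - 1) (by omega) hg
        (fun j hj => by
          rw [← Function.iterate_succ_apply (fun h => glTangentMap h N)]
          exact hh (j + 1) (by omega)) k (by omega)
    have h2 : (fun h => glTangentMap h N)^[k] (h * glTangentMap g N) = 0 :=
      ih h (glTangentMap g N) B (A - 1) (by omega) hh
        (fun j hj => by
          rw [← Function.iterate_succ_apply (fun h => glTangentMap h N)]
          exact hg (j + 1) (by omega)) k (by omega)
    rw [h1, h2, add_zero]

/-- **The derivation of a nilpotent matrix is locally nilpotent**: for nilpotent `N` every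
polynomial is killed by some power of `N·`. [cite: Poonen2005, Thm. 2 (p0002:L9); proof step, not in the source] -/
theorem exists_iterate_glTangentMap_eq_zero {N : Matrix σ σ ℂ} (hN : IsNilpotent N)
    (g : MvPolynomial σ ℂ) : ∃ K, ∀ k, K ≤ k → (fun h => glTangentMap h N)^[k] g = 0 := by
  obtain ⟨p, hp⟩ := hN
  induction g using MvPolynomial.induction_on with
  | C r =>
    refine ⟨1, fun k hk => ?_⟩
    obtain ⟨k, rfl⟩ : ∃ k', k = k' + 1 := ⟨k - 1, by omega⟩
    rw [Function.iterate_succ_apply, glTangentMap_C_left, iterate_glTangentMap_zero]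
  | add g h hg hh =>
    obtain ⟨A, hA⟩ := hg
    obtain ⟨B, hB⟩ := hh
    exact ⟨max A B, fun k hk => by
      rw [iterate_glTangentMap_add, hA k (le_of_max_le_left hk), hB k (le_of_max_le_right hk),
        add_zero]⟩
  | mul_X g l hg =>
    obtain ⟨A, hA⟩ := hg
    refine ⟨A + p, iterate_glTangentMap_mul_eq_zero N (A + p) g (X l) A p rfl hA ?_⟩
    intro j hj
    have hX : (X l : MvPolynomial σ ℂ) = ∑ i, (Pi.single l (1 : ℂ) : σ → ℂ) i • (X i : MvPolynomial σ ℂ) := by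
      rw [Finset.sum_eq_single l (fun i _ hil => by rw [Pi.single_eq_of_ne hil, zero_smul])
        (fun h => absurd (Finset.mem_univ l) h), Pi.single_eq_same, one_smul]
    rw [hX, iterate_glTangentMap_linearForm, pow_eq_zero_of_le hj hp]
    simp

end DerivationAlong

/-! ### §7 Weight compatibility: `𝔤𝔩(W)_f` is closed under Jordan–Chevalley parts -/

section JordanChevalley

variable {σ : Type*} [Fintype σ] [DecidableEq σ]

omit [Fintype σ] in
/-- `coeff_e (x_i ∂_j h)`: zero unless `e_i ≥ 1`, and then a multiple of `coeff_{e - εᵢ + εⱼ} h`.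
[folklore] -/
private theorem coeff_X_mul_pderiv' (i j : σ) (h : MvPolynomial σ ℂ) (e : σ →₀ ℕ) :
    coeff e (X i * pderiv j h) =
      if e i = 0 then 0 else
        (((e - Finsupp.single i 1 : σ →₀ ℕ) j + 1 : ℕ) : ℂ) *
          coeff (e - Finsupp.single i 1 + Finsupp.single j 1) h := by
  rw [coeff_X_mul']
  by_cases hi : e i = 0
  · rw [if_neg (by simpa using hi), if_pos hi]
  · rw [if_pos (by simpa using hi), if_neg hi, coeff_pderiv, mul_comm]
    push_cast
    ring

omit [Fintype σ] [DecidableEq σ] in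
/-- Weight bookkeeping: `w(e - εᵢ + εⱼ) = w(e)` when `e_i ≥ 1` and `a_i = a_j`. [folklore] -/
private theorem weight_sub_add_eq (a : σ → ℂ) {i j : σ} (hij : a i = a j) {e : σ →₀ ℕ} (hi : e i ≠ 0) :
    Finsupp.weight a (e - Finsupp.single i 1 + Finsupp.single j 1) = Finsupp.weight a e := by
  classical
  have he : e = e - Finsupp.single i 1 + Finsupp.single i 1 := by
    ext l
    simp only [Finsupp.coe_add, Finsupp.coe_tsub, Pi.add_apply, Pi.sub_apply, Finsupp.single_apply]
    split_ifs with hl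
    · subst hl; omega
    · omega
  conv_rhs => rw [he]
  simp only [map_add, Finsupp.weight_apply, Finsupp.sum_single_index, zero_smul, one_smul, hij]

/-- For `N` compatible with the weights (`N_{ij} ≠ 0 → a_i = a_j`), `N·` commutes with taking the
weight-`c` component. [folklore] -/
private theorem weightedHomogeneousComponent_glTangentMap (a : σ → ℂ) {N : Matrix σ σ ℂ}
    (hN : ∀ i j, N i j ≠ 0 → a i = a j) (c : ℂ) (h : MvPolynomial σ ℂ) :
    weightedHomogeneousComponent a c (glTangentMap h N) =
      glTangentMap (weightedHomogeneousComponent a c h) N := by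
  classical
  ext e
  rw [coeff_weightedHomogeneousComponent, glTangentMap_apply, glTangentMap_apply, coeff_sum,
    coeff_sum]
  simp_rw [coeff_sum, coeff_smul, coeff_X_mul_pderiv', coeff_weightedHomogeneousComponent]
  by_cases hc : Finsupp.weight a e = c
  · rw [if_pos hc]
    refine Finset.sum_congr rfl fun i _ => Finset.sum_congr rfl fun j _ => ?_
    by_cases hNij : N i j = 0
    · simp [hNij]
    by_cases hi : e i = 0
    · simp [hi]
    rw [if_neg hi, if_neg hi, weight_sub_add_eq a (hN i j hNij) hi, if_pos hc]
  · rw [if_neg hc, eq_comm]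
    refine Finset.sum_eq_zero fun i _ => Finset.sum_eq_zero fun j _ => ?_
    by_cases hNij : N i j = 0
    · simp [hNij]
    by_cases hi : e i = 0
    · simp [hi]
    rw [if_neg hi, weight_sub_add_eq a (hN i j hNij) hi, if_neg hc]
    simp

/-- Taking the weight-`c` component turns `diag(a)·` into multiplication by `c`. [folklore] -/
private theorem weightedHomogeneousComponent_glTangentMap_diagonal (a : σ → ℂ) (c : ℂ)
    (h : MvPolynomial σ ℂ) :
    weightedHomogeneousComponent a c (glTangentMap h (diagonal a)) =
      c • weightedHomogeneousComponent a c h := by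
  classical
  ext e
  rw [coeff_weightedHomogeneousComponent, coeff_glTangentMap_diagonal, coeff_smul,
    coeff_weightedHomogeneousComponent]
  have hw : (∑ i, a i * (e i : ℂ)) = Finsupp.weight a e := by
    rw [Finsupp.weight_apply, Finsupp.sum_fintype _ _ (fun i => by simp)]
    exact Finset.sum_congr rfl fun i _ => by rw [mul_comm, nsmul_eq_mul]
  rw [hw]
  split_ifs with hc
  · rw [hc, smul_eq_mul]
  · rw [smul_zero]

/-- **Key lemma.** If `diag(a) + N` annihilates `g`, with `N` nilpotent and weight-compatible
(`N_{ij} ≠ 0 → a_i = a_j`, e.g. `N` commuting with `diag(a)`), then `diag(a)` alone annihilates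
`g`: on the weight-`c` component `N·` acts as `-c`, but `N·` is locally nilpotent, so the
component vanishes for `c ≠ 0`. [cite: Poonen2005, Thm. 2 (p0002:L9); proof step, not in the source] -/
theorem diagonal_mem_glAnn_of_add_mem {a : σ → ℂ} {N : Matrix σ σ ℂ} (hNnil : IsNilpotent N)
    (hN : ∀ i j, N i j ≠ 0 → a i = a j) {g : MvPolynomial σ ℂ}
    (h : diagonal a + N ∈ glAnn g) : diagonal a ∈ glAnn g := by
  classical
  have h0 : glTangentMap g (diagonal a) + glTangentMap g N = 0 := by
    rw [← map_add]; simpa [glAnn] using h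
  -- each weight component with nonzero weight vanishes
  have hcomp : ∀ c : ℂ, c ≠ 0 → weightedHomogeneousComponent a c g = 0 := by
    intro c hc
    set gc := weightedHomogeneousComponent a c g with hgc
    have hT : glTangentMap gc N = (-c) • gc := by
      have := congr_arg (weightedHomogeneousComponent a c) h0
      rw [map_add, map_zero, weightedHomogeneousComponent_glTangentMap_diagonal,
        weightedHomogeneousComponent_glTangentMap a hN] at this
      rw [neg_smul, eq_neg_iff_add_eq_zero, add_comm]
      exact this
    have hiter : ∀ k, (fun h => glTangentMap h N)^[k] gc = (-c) ^ k • gc := by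
      intro k
      induction k with
      | zero => simp
      | succ k ih => rw [Function.iterate_succ_apply', ih, glTangentMap_smul_left, hT, smul_smul,
          pow_succ]
    obtain ⟨K, hK⟩ := exists_iterate_glTangentMap_eq_zero hNnil gc
    have := hK K le_rfl
    rw [hiter K] at this
    exact (smul_eq_zero.mp this).resolve_left (pow_ne_zero K (neg_ne_zero.mpr hc))
  -- hence `diag(a)·g = 0` coefficientwise
  change glTangentMap g (diagonal a) = 0
  ext e
  rw [coeff_glTangentMap_diagonal, coeff_zero]
  by_cases hw : (∑ i, a i * (e i : ℂ)) = 0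
  · rw [hw, zero_mul]
  · have hwe : Finsupp.weight a e = ∑ i, a i * (e i : ℂ) := by
      rw [Finsupp.weight_apply, Finsupp.sum_fintype _ _ (fun i => by simp)]
      exact Finset.sum_congr rfl fun i _ => by rw [nsmul_eq_mul, mul_comm]
    have hce : coeff e g = coeff e (weightedHomogeneousComponent a (Finsupp.weight a e) g) := by
      rw [coeff_weightedHomogeneousComponent, if_pos rfl]
    rw [hce, hcomp _ (hwe ▸ hw), coeff_zero, mul_zero]

/-- **`𝔤𝔩(W)_f` is closed under Jordan–Chevalley parts (diagonalisable form).** If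
`X = S + N ∈ 𝔤𝔩(W)_f` with `S = P diag(a) P⁻¹` diagonalisable, `N` nilpotent and `SN = NS`, then
`S ∈ 𝔤𝔩(W)_f` and `N ∈ 𝔤𝔩(W)_f` — the Lie algebra of the stabiliser is algebraic. [cite: Poonen2005, Thm. 2 (p0002:L9); proof step, not in the source] -/
theorem jordanChevalley_mem_glAnn {f : MvPolynomial σ ℂ} {S N P : Matrix σ σ ℂ} {a : σ → ℂ}
    (hP : IsUnit P.det) (hS : S = P * diagonal a * P⁻¹) (hN : IsNilpotent N) (hc : S * N = N * S)
    (hmem : S + N ∈ glAnn f) : S ∈ glAnn f ∧ N ∈ glAnn f := by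
  have hP' : IsUnit P⁻¹.det := Matrix.isUnit_nonsing_inv_det P hP
  set N' := P⁻¹ * N * P with hN'
  have hPP : P⁻¹ * P = 1 := Matrix.nonsing_inv_mul P hP
  have hPP' : P * P⁻¹ = 1 := Matrix.mul_nonsing_inv P hP
  -- transport to `f' = P⁻¹·f`, where `diag(a) + N'` annihilates
  have hconj : P⁻¹⁻¹ * (diagonal a + N') * P⁻¹ = S + N := by
    rw [Matrix.nonsing_inv_nonsing_inv P hP, Matrix.mul_add, Matrix.add_mul, hS, hN']
    congr 1
    rw [← Matrix.mul_assoc, ← Matrix.mul_assoc, hPP', Matrix.one_mul, Matrix.mul_assoc, hPP',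
      Matrix.mul_one]
  have hmem' : diagonal a + N' ∈ glAnn (linSubst σ ℂ P⁻¹ f) := by
    rw [mem_glAnn_linSubst_iff P⁻¹ hP', hconj]; exact hmem
  have hN'nil : IsNilpotent N' := by
    obtain ⟨k, hk⟩ := hN
    refine ⟨k, ?_⟩
    have : ∀ m : ℕ, N' ^ m = P⁻¹ * N ^ m * P := by
      intro m
      induction m with
      | zero => rw [pow_zero, pow_zero, Matrix.mul_one, hPP]
      | succ m ih =>
        rw [pow_succ, ih, hN', pow_succ]
        simp only [Matrix.mul_assoc]
        rw [← Matrix.mul_assoc P P⁻¹, hPP', Matrix.one_mul]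
    rw [this, hk, Matrix.mul_zero, Matrix.zero_mul]
  have hcomm' : diagonal a * N' = N' * diagonal a := by
    have hD : diagonal a = P⁻¹ * S * P := by
      rw [hS, ← Matrix.mul_assoc, ← Matrix.mul_assoc, hPP, Matrix.one_mul, Matrix.mul_assoc, hPP,
        Matrix.mul_one]
    rw [hD, hN']
    calc P⁻¹ * S * P * (P⁻¹ * N * P) = P⁻¹ * S * (P * P⁻¹) * N * P := by
          simp only [Matrix.mul_assoc]
      _ = P⁻¹ * (S * N) * P := by rw [hPP', Matrix.mul_one]; simp only [Matrix.mul_assoc]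
      _ = P⁻¹ * (N * S) * P := by rw [hc]
      _ = P⁻¹ * N * (P * P⁻¹) * S * P := by rw [hPP', Matrix.mul_one]; simp only [Matrix.mul_assoc]
      _ = P⁻¹ * N * P * (P⁻¹ * S * P) := by simp only [Matrix.mul_assoc]
  have hcompat : ∀ i j, N' i j ≠ 0 → a i = a j := by
    intro i j hij
    have := congr_fun (congr_fun hcomm' i) j
    rw [Matrix.diagonal_mul, Matrix.mul_diagonal] at this
    by_contra hne
    exact hij (mul_left_cancel₀ (sub_ne_zero.mpr hne) (by rw [sub_mul, this, mul_comm, sub_self, mul_zero]))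
  have hD : diagonal a ∈ glAnn (linSubst σ ℂ P⁻¹ f) :=
    diagonal_mem_glAnn_of_add_mem hN'nil hcompat hmem'
  have hS' : S ∈ glAnn f := by
    rw [hS, ← Matrix.nonsing_inv_nonsing_inv P hP, Matrix.nonsing_inv_nonsing_inv P hP]
    have := (mem_glAnn_linSubst_iff P⁻¹ hP' (diagonal a) f).mp hD
    rwa [Matrix.nonsing_inv_nonsing_inv P hP] at this
  refine ⟨hS', ?_⟩
  have := Submodule.sub_mem _ hmem hS'
  rwa [add_sub_cancel_left] at this

/-- **`𝔤𝔩(W)_f` is closed under Jordan–Chevalley parts (semisimple form)**: if `S` is semisimple,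
`N` nilpotent, `SN = NS` and `S + N ∈ 𝔤𝔩(W)_f`, then `S, N ∈ 𝔤𝔩(W)_f`. [cite: Poonen2005, Thm. 2 (p0002:L9); proof step, not in the source] -/
theorem jordanChevalley_mem_glAnn_of_isSemisimple {f : MvPolynomial σ ℂ} {S N : Matrix σ σ ℂ}
    (hS : Module.End.IsSemisimple (Matrix.toLin' S)) (hN : IsNilpotent N) (hc : S * N = N * S)
    (hmem : S + N ∈ glAnn f) : S ∈ glAnn f ∧ N ∈ glAnn f := by
  obtain ⟨P, a, hP, hSP⟩ := exists_conj_diagonal_of_isSemisimple S hS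
  exact jordanChevalley_mem_glAnn hP hSP hN hc hmem

/-- **Jordan–Chevalley decomposition of a complex matrix** (Mathlib's decomposition of the
endomorphism `toLin' X`, read back as matrices). [cite: Poonen2005, Thm. 2 (p0002:L9); proof step, not in the source] -/
theorem exists_jordanChevalley_matrix (X : Matrix σ σ ℂ) :
    ∃ S N : Matrix σ σ ℂ, Module.End.IsSemisimple (Matrix.toLin' S) ∧ IsNilpotent N ∧
      S * N = N * S ∧ X = S + N := by
  obtain ⟨n, hn, s, hs, hnil, hss, hsum⟩ :=
    Module.End.exists_isNilpotent_isSemisimple (f := Matrix.toLin' X)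
  refine ⟨LinearMap.toMatrix' s, LinearMap.toMatrix' n, by rwa [Matrix.toLin'_toMatrix'], ?_, ?_, ?_⟩
  · obtain ⟨k, hk⟩ := hnil
    refine ⟨k, ?_⟩
    have hpow : ∀ m : ℕ, LinearMap.toMatrix' n ^ m = LinearMap.toMatrix' (n ^ m) := by
      intro m
      induction m with
      | zero => rw [pow_zero, pow_zero, LinearMap.toMatrix'_one]
      | succ m ih => rw [pow_succ, ih, ← LinearMap.toMatrix'_mul, ← pow_succ]
    rw [hpow, hk, map_zero]
  · have hcomm : s * n = n * s := by
      rw [Algebra.adjoin_singleton_eq_range_aeval] at hn hs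
      obtain ⟨p, rfl⟩ := (AlgHom.mem_range _).mp hn
      obtain ⟨q, rfl⟩ := (AlgHom.mem_range _).mp hs
      rw [← map_mul, ← map_mul, mul_comm]
    rw [← LinearMap.toMatrix'_mul, ← LinearMap.toMatrix'_mul, hcomm]
  · rw [← map_add, add_comm, ← hsum, LinearMap.toMatrix'_toLin']

end JordanChevalley

/-! ### §8 Every infinitesimal symmetry of a smooth form of degree `≥ 3` is nilpotent -/

section Nilpotent

open Literature.AlgebraicGeometry.Motives.SmoothHypersurface

variable {n : ℕ}

/-- **The annihilator of a smooth form of degree `≥ 3` consists of nilpotent matrices**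
(equivalently: the identity component of its stabiliser in `GL_{n+2}(ℂ)` is unipotent). Write
`X = S + N` (Jordan–Chevalley); `S ∈ 𝔤𝔩(W)_F` (`jordanChevalley_mem_glAnn_of_isSemisimple`), so
`S = 0` (`eq_zero_of_mem_glAnn_of_isSemisimple`) and `X = N`. Typed vs printed: this is the
semisimple half of `𝔤𝔩(W)_F = 0` (⟺ finite stabiliser, `finite_linStabilizer_iff_glAnn_eq_bot`),
the Lie-algebra form over `ℂ` of Matsumura–Monsky's / Poonen's finiteness theorem; the nilpotent
half (`N = 0`) is not proved here. [cite: Poonen2005, Thm. 2 (p0002:L9)] -/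
theorem isNilpotent_of_mem_glAnn_of_isNonsingularForm {F : MvPolynomial (Fin (n + 2)) ℂ}
    (hF : IsNonsingularForm ℂ F) {d : ℕ} (hFd : F.IsHomogeneous d) (hd : 3 ≤ d)
    {X : Matrix (Fin (n + 2)) (Fin (n + 2)) ℂ} (hmem : X ∈ glAnn F) : IsNilpotent X := by
  obtain ⟨S, N, hS, hN, hc, rfl⟩ := exists_jordanChevalley_matrix X
  have hSmem : S ∈ glAnn F := (jordanChevalley_mem_glAnn_of_isSemisimple hS hN hc hmem).1
  have hS0 : S = 0 := eq_zero_of_mem_glAnn_of_isSemisimple hF hFd hd hS hSmem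
  rw [hS0, zero_add]
  exact hN

end Nilpotent

end Literature.Computability.AlgebraicComplexity

end
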